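import Summits.BirchSwinnertonDyer.Rank1Residual.Partition.MainConjecturesAnticyclotomicGood
import Literature.NumberTheory.EllipticCurves.HeegnerPointsKolyvaginGoodReductionProofs
import HarnessLib

/-!
# Tamagawa numbers at a CLASSICAL HEEGNER field for EVERY prime `p` (JSW17 (eq:tamK)
# `∏_w c_w(E/K) = ∏_ℓ c_ℓ(E/ℚ)²` as an identity of natural numbers), and the good-ordinary
# anticyclotomic links ⇒ STEP L at ANY prime (cell `b2b-bsdres`, GLUE seat gen 3; companion of
# `Partition/MainConjecturesAnticyclotomicGood.lean`, whose Tamagawa steps were `p ≥ 5` only)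

HONEST FRAMING (cell `b2b-bsdres`, run/shared/lean/b2b/bsd-rank1-residual/, verbatim in every
file): the goal of the cell is to DELETE the COMBINATION-SHAPED residual classes of the
Birch–Swinnerton-Dyer formula for ALL analytic-rank `≤ 1` elliptic curves over `ℚ` — "full BSD
formula for every rank `≤ 1` curve in class `C`" assembled STRICTLY from published theorems — so
that the rank-`≤ 1` remainder becomes exactly the CONSTRUCTION-SHAPED classes, which are TYPED
(missing-input `Prop`s), NOT attempted. This is not "finishing BSD". Research routes; no claim
beyond the stated classes; nothing booked; no label changes. THEOREMS ONLY (no definition, no named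
fact, no `sorry`).

## Why this file

The two Tamagawa transports behind STEP L over an imaginary quadratic `K` —
`ord_p ∏_{w∣N⁺} c_w(E/K) = ord_p ∏_w c_w(E/K)` and `ord_p ∏_w c_w(E/K) = 2·ord_p ∏_ℓ c_ℓ(E)` — are in
the tree (multr1) for a GENERAL quadratic `K` whose non-split bad primes are multiplicative with
`E[p]` ramified, via Kodaira–Néron `p`-unit arguments that need `p ≥ 5`
(`padicValNat_tamagawaProductSplit_eq`, `padicValNat_tamagawaProduct_baseChange_quadratic_eq_two_mul`).
At a CLASSICAL HEEGNER field (every `ℓ ∣ N_E` splits in `K`) no `p` is involved at all: for a split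
bad `ℓ` the two places `w, w̄ ∣ ℓ` have `K_w = ℚ_ℓ`, so `c_w(E/K) = c_w̄(E/K) = c_ℓ(E)`
(`localTamagawaNumber_baseChange_eq_of_degree_one`); for `ℓ ∤ N_E` (split or not) `E` and `E/K` have
good reduction above `ℓ` (`hasGoodReductionAt_baseChange_of_hasGoodReductionAt_rat`, Silverman VII.5.1)
and every factor is `1` (`localTamagawaNumber_eq_one_of_hasGoodReductionAt`). Hence, as IDENTITIES OF
NATURAL NUMBERS (Jetchev–Skinner–Wan 2017 §7.3.1 (eq:tamK), verbatim "`∏_w c_w(E/K) = ∏_ℓ c_ℓ(E/ℚ)²`";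
Gross 1991 (1.2); CGLS 2022 (5.6)):

* `tamagawaProductSplit_eq_tamagawaProduct_baseChange_of_allSplit` — `∏_{w∣N⁺} c_w(E/K) = ∏_w c_w(E/K)`;
* `tamagawaProduct_baseChange_eq_sq_of_allSplit` — `∏_w c_w(E/K) = (∏_ℓ c_ℓ(E))²`;
  `padicValNat_tamagawaProduct_baseChange_eq_two_mul_of_allSplit` — its `p`-adic reading, EVERY `p`.

With them, the good-ordinary tree-object links of the companion file give STEP L at EVERY prime
(in particular `p = 3`, row C16 = Yan–Zhu 2026):
`indexLowerBoundAt_of_onTreeGoodLowerLinks_of_allSplit`, `indexIdentityAt_of_onTreeGoodLinks_of_allSplit`,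
`imcLowerWaldspurgerOnTreeGoodAt_iff_indexLowerBoundAt_of_allSplit`,
`indexLowerBoundAt_of_heegner_of_onTreeGoodLowerLinks_anyPrime`,
`indexLowerBoundAt_of_heegner_of_onTreeGoodInputs_anyPrime` (the `p ≥ 5` versions of the companion
become special cases). Class-level consumers at `p = 3`: `Partition/MainConjecturesAnticyclotomicGoodThree.lean`.

References: [JetchevSkinnerWan2017] §7.3.1 (eq:tamK), §7.4.1 (eq:shalowerK-1) (arXiv:1512.06894
p. 30); [GrossLMS1991] (1.2), Conj. (2.2); [CastellaGrossiLeeSkinner2022] (5.6); [Castella2018] Thm.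
2.3, 3.2, §5; [SilvermanAEC2009] VII.5 Prop. 5.1, VII.6 Ex. 7.6; [YanZhu2024MainConjNonCM] Thm. 4.12.
-/

set_option autoImplicit false

noncomputable section

open scoped Classical

open WeierstrassCurve NumberField IsDedekindDomain Literature.NumberTheory.EllipticCurves
  Literature.NumberTheory.EllipticCurves.ModularForms
  Literature.NumberTheory.EllipticCurves.Rank1Residual
  Summit.BirchSwinnertonDyer.Rank1Residual.X11b.AcSelmer

namespace Summit.BirchSwinnertonDyer.Rank1Residual.X11b

/-! ### Tamagawa numbers in a quadratic base change in which every bad prime splits, any `p` -/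

section Tamagawa

variable (W : WeierstrassCurve ℚ) [W.IsElliptic] (K : Type) [Field K] [NumberField K]

/-- **The fibre identity at a field in which every bad prime splits**: for `[K:ℚ] = 2` and every
finite place `v` of `ℚ`, `∏_{w ∣ v} c_w(E/K) = c_v(E)²` — split `v`: two degree-one places, each with
`c_w = c_v(E)`; non-split `v`: one place, `v ∤ N_E`, so `c_v(E) = 1 = c_w(E/K)` (good reduction is
stable under base change). JSW17 (eq:tamK) place by place; no hypothesis on any prime `p`.
[cite: JetchevSkinnerWan2017, §7.3.1 (eq:tamK)] [cite: SilvermanAEC2009, VII.5 Prop. 5.1 and VII.6 Ex. 7.6] -/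
theorem prod_fibre_localTamagawaNumber_eq_sq_of_allSplit (h2 : Module.finrank ℚ K = 2)
    (hsplit : ∀ (ℓ : ℕ) [Fact ℓ.Prime], ℓ ∣ W.conductorNorm ℤ → SplitsIn K ℓ)
    (v : HeightOneSpectrum (𝓞 ℚ)) :
    (∏ w ∈ (HeightOneSpectrum.finite_setOf_under_eq_of_numberField (K := K) v).toFinset,
        ((W.baseChange K).baseChange (w.adicCompletion K)).localTamagawaNumber
          (w.adicCompletionIntegers K)) =
      ((W.baseChange (v.adicCompletion ℚ)).localTamagawaNumber (v.adicCompletionIntegers ℚ)) ^ 2 := by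
  haveI hEK : (W.baseChange K).IsElliptic := by rw [baseChange]; infer_instance
  set ℓ : ℕ := (Rat.HeightOneSpectrum.primesEquiv v : ℕ) with hℓdef
  haveI hℓ : Fact ℓ.Prime := ⟨(Rat.HeightOneSpectrum.primesEquiv v).2⟩
  have hvℓ : (Rat.HeightOneSpectrum.primesEquiv v : ℕ) = ℓ := rfl
  have hfin := HeightOneSpectrum.finite_setOf_under_eq_of_numberField (K := K) v
  -- one place above `v` (inert or ramified): `ℓ ∤ N_E`, good reduction on both sides
  have key : ∀ (w : HeightOneSpectrum (𝓞 K)),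
      {w' : HeightOneSpectrum (𝓞 K) | w'.under (𝓞 ℚ) = v} = {w} →
      (∏ w ∈ hfin.toFinset,
          ((W.baseChange K).baseChange (w.adicCompletion K)).localTamagawaNumber
            (w.adicCompletionIntegers K)) =
        ((W.baseChange (v.adicCompletion ℚ)).localTamagawaNumber (v.adicCompletionIntegers ℚ)) ^ 2 := by
    intro w hset
    have hw : w.under (𝓞 ℚ) = v := by
      have h : w ∈ ({w} : Set (HeightOneSpectrum (𝓞 K))) := Set.mem_singleton _
      rwa [← hset] at h
    have hF : hfin.toFinset = {w} := by
      ext w'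
      rw [Set.Finite.mem_toFinset, hset]
      simp
    have hns : ¬ SplitsIn K ℓ := by
      show ((Ideal.span {(ℓ : ℤ)}).primesOver (𝓞 K)).ncard ≠ 2
      rw [hℓdef, ncard_primesOver_span_eq K v, hset, Set.ncard_singleton]
      decide
    have hℓN : ¬ ℓ ∣ W.conductorNorm ℤ := fun h ↦ hns (hsplit ℓ h)
    have hgood : W.HasGoodReductionAt v :=
      (hasGoodReductionAtPrime_primesEquiv_iff_holds W v ℓ hvℓ).mp
        (by
          by_contra hbad'
          exact hℓN ((W.dvd_conductorNorm_iff_not_hasGoodReductionAtPrime ℓ).mpr hbad'))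
    haveI : w.asIdeal.LiesOver v.asIdeal := ⟨by rw [← hw]; rfl⟩
    have hgoodK : (W.baseChange K).HasGoodReductionAt w :=
      hasGoodReductionAt_baseChange_of_hasGoodReductionAt_rat W v w hgood
    rw [hF, Finset.prod_singleton, W.localTamagawaNumber_eq_one_of_hasGoodReductionAt_holds v hgood,
      (W.baseChange K).localTamagawaNumber_eq_one_of_hasGoodReductionAt_holds w hgoodK]
    norm_num
  rcases placesOver_trichotomy_of_finrank_eq_two K h2 v with
    ⟨w₁, w₂, hne, hset, hef⟩ | ⟨w, hset, -, -⟩ | ⟨w, hset, -, -⟩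
  · -- split: two places of degree one
    have hw₁ : w₁.under (𝓞 ℚ) = v := by
      have h : w₁ ∈ ({w₁, w₂} : Set (HeightOneSpectrum (𝓞 K))) := Set.mem_insert _ _
      rwa [← hset] at h
    have hw₂ : w₂.under (𝓞 ℚ) = v := by
      have h : w₂ ∈ ({w₁, w₂} : Set (HeightOneSpectrum (𝓞 K))) :=
        Set.mem_insert_of_mem _ (Set.mem_singleton _)
      rwa [← hset] at h
    obtain ⟨he₁, hf₁⟩ := hef w₁ hw₁
    obtain ⟨he₂, hf₂⟩ := hef w₂ hw₂
    have hF : hfin.toFinset = {w₁, w₂} := by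
      ext w
      rw [Set.Finite.mem_toFinset, hset]
      simp
    have c₁ := localTamagawaNumber_baseChange_eq_of_degree_one W w₁ he₁ hf₁
    have c₂ := localTamagawaNumber_baseChange_eq_of_degree_one W w₂ he₂ hf₂
    rw [hw₁] at c₁
    rw [hw₂] at c₂
    rw [hF, Finset.prod_pair hne, c₁, c₂, sq]
  · exact key w hset
  · exact key w hset

/-- **`∏_w c_w(E/K) = (∏_ℓ c_ℓ(E))²` at a quadratic field in which every bad prime of `E` splits**
— Jetchev–Skinner–Wan 2017 §7.3.1 (eq:tamK), verbatim "`∏_w c_w(E/K) = ∏_ℓ c_ℓ(E/ℚ)²`", as an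
identity of natural numbers (no prime `p` involved): the Tamagawa product of `E_K` is a finite
product over the places of `K`, regrouped along the finite fibres of `w ↦ w ∩ ℤ`
(`Finset.prod_fiberwise_of_maps_to`), and `prod_fibre_localTamagawaNumber_eq_sq_of_allSplit`.
[cite: JetchevSkinnerWan2017, §7.3.1 (eq:tamK)] [cite: GrossLMS1991, §1 (1.2)] -/
theorem tamagawaProduct_baseChange_eq_sq_of_allSplit (h2 : Module.finrank ℚ K = 2)
    (hsplit : ∀ (ℓ : ℕ) [Fact ℓ.Prime], ℓ ∣ W.conductorNorm ℤ → SplitsIn K ℓ) :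
    (W.baseChange K).tamagawaProduct = W.tamagawaProduct ^ 2 := by
  haveI hEK : (W.baseChange K).IsElliptic := by rw [baseChange]; infer_instance
  set cK : HeightOneSpectrum (𝓞 K) → ℕ := fun w =>
    ((W.baseChange K).baseChange (w.adicCompletion K)).localTamagawaNumber
      (w.adicCompletionIntegers K) with hcK
  set cQ : HeightOneSpectrum (𝓞 ℚ) → ℕ := fun v =>
    (W.baseChange (v.adicCompletion ℚ)).localTamagawaNumber (v.adicCompletionIntegers ℚ) with hcQ
  have hfinK : (Function.mulSupport cK).Finite :=
    (W.baseChange K).mulSupport_localTamagawaNumber_finite_holds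
  have hfinQ : (Function.mulSupport cQ).Finite := W.mulSupport_localTamagawaNumber_finite_holds
  -- fibres of `K → ℚ` on places and the finite index sets
  set F : HeightOneSpectrum (𝓞 ℚ) → Finset (HeightOneSpectrum (𝓞 K)) := fun v =>
    (HeightOneSpectrum.finite_setOf_under_eq_of_numberField (K := K) v).toFinset with hF
  have hmemF : ∀ v w, w ∈ F v ↔ w.under (𝓞 ℚ) = v := fun v w => by
    simp [hF, Set.Finite.mem_toFinset]
  set SQ : Finset (HeightOneSpectrum (𝓞 ℚ)) :=
    hfinK.toFinset.image (fun w => w.under (𝓞 ℚ)) ∪ hfinQ.toFinset with hSQ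
  set SK : Finset (HeightOneSpectrum (𝓞 K)) := SQ.biUnion F with hSK
  have hsubK : Function.mulSupport cK ⊆ ↑SK := by
    intro w hw
    rw [Finset.mem_coe, hSK, Finset.mem_biUnion]
    refine ⟨w.under (𝓞 ℚ), ?_, (hmemF _ _).mpr rfl⟩
    rw [hSQ, Finset.mem_union, Finset.mem_image]
    exact Or.inl ⟨w, hfinK.mem_toFinset.mpr hw, rfl⟩
  have hsubQ : Function.mulSupport cQ ⊆ ↑SQ := fun v hv => by
    rw [Finset.mem_coe, hSQ, Finset.mem_union]
    exact Or.inr (hfinQ.mem_toFinset.mpr hv)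
  have hK' : (W.baseChange K).tamagawaProduct = ∏ w ∈ SK, cK w := by
    rw [show (W.baseChange K).tamagawaProduct = ∏ᶠ w, cK w from rfl,
      finprod_eq_prod_of_mulSupport_subset cK hsubK]
  have hQ' : W.tamagawaProduct = ∏ v ∈ SQ, cQ v := by
    rw [show W.tamagawaProduct = ∏ᶠ v, cQ v from rfl, finprod_eq_prod_of_mulSupport_subset cQ hsubQ]
  -- regroup the `K`-side along the fibres
  have hmaps : ∀ w ∈ SK, w.under (𝓞 ℚ) ∈ SQ := by
    intro w hw
    rw [hSK, Finset.mem_biUnion] at hw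
    obtain ⟨v, hv, hwv⟩ := hw
    rwa [(hmemF v w).mp hwv]
  have hfib : ∀ v ∈ SQ, SK.filter (fun w => w.under (𝓞 ℚ) = v) = F v := by
    intro v hv
    ext w
    simp only [Finset.mem_filter, hmemF]
    constructor
    · exact fun h => h.2
    · intro h
      refine ⟨?_, h⟩
      rw [hSK, Finset.mem_biUnion]
      exact ⟨v, hv, (hmemF v w).mpr h⟩
  rw [hK', hQ', ← Finset.prod_fiberwise_of_maps_to hmaps, ← Finset.prod_pow]
  refine Finset.prod_congr rfl fun v hv => ?_
  rw [hfib v hv]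
  exact prod_fibre_localTamagawaNumber_eq_sq_of_allSplit W K h2 hsplit v

/-- **`ord_p ∏_w c_w(E/K) = 2 · ord_p ∏_ℓ c_ℓ(E)` for EVERY prime `p`** at a quadratic field in which
every bad prime splits — the `p`-adic reading of `tamagawaProduct_baseChange_eq_sq_of_allSplit`; the
tree's `padicValNat_tamagawaProduct_baseChange_quadratic_eq_two_mul` (`p ≥ 5`, general quadratic `K`)
restricted to such `K` but freed of the hypothesis on `p`. [cite: JetchevSkinnerWan2017, §7.3.1 (eq:tamK)] -/
theorem padicValNat_tamagawaProduct_baseChange_eq_two_mul_of_allSplit (p : ℕ) [Fact p.Prime]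
    (h2 : Module.finrank ℚ K = 2)
    (hsplit : ∀ (ℓ : ℕ) [Fact ℓ.Prime], ℓ ∣ W.conductorNorm ℤ → SplitsIn K ℓ) :
    padicValNat p (W.baseChange K).tamagawaProduct = 2 * padicValNat p W.tamagawaProduct := by
  rw [tamagawaProduct_baseChange_eq_sq_of_allSplit W K h2 hsplit, padicValNat.pow]

/-- **`∏_{w∣N⁺} c_w(E/K) = ∏_w c_w(E/K)` as natural numbers at a quadratic field in which every bad
prime splits** (`N⁺ = N`): the factors of the two `finprod`s agree place by place — over a split
conductor prime they are the same factor; any other place lies over some `ℓ ∤ N_E` (a non-split bad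
`ℓ` is excluded by hypothesis), where `E/K` has good reduction and `c_w(E/K) = 1`. The tree's
`padicValNat_tamagawaProductSplit_eq` (`p ≥ 5`) freed of `p` on such `K`.
[cite: Castella2018, Thm. 2.3 (arXiv:1704.06608 p. 5), the term ∏_{w∣N⁺}] [cite: JetchevSkinnerWan2017, §7.3.1 (eq:tamK)] -/
theorem tamagawaProductSplit_eq_tamagawaProduct_baseChange_of_allSplit
    (hsplit : ∀ (ℓ : ℕ) [Fact ℓ.Prime], ℓ ∣ W.conductorNorm ℤ → SplitsIn K ℓ) :
    tamagawaProductSplit W K = (W.baseChange K).tamagawaProduct := by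
  haveI hEK : (W.baseChange K).IsElliptic := by rw [baseChange]; infer_instance
  rw [show tamagawaProductSplit W K = ∏ᶠ w : HeightOneSpectrum (𝓞 K),
      (if IsPlaceOverSplitConductorPrime W K w then
        ((W.baseChange K).baseChange (w.adicCompletion K)).localTamagawaNumber
          (w.adicCompletionIntegers K) else 1) from rfl,
    show (W.baseChange K).tamagawaProduct = ∏ᶠ w : HeightOneSpectrum (𝓞 K),
      ((W.baseChange K).baseChange (w.adicCompletion K)).localTamagawaNumber
        (w.adicCompletionIntegers K) from rfl]
  refine finprod_congr fun w ↦ ?_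
  by_cases hcond : IsPlaceOverSplitConductorPrime W K w
  · simp only [hcond, if_true]
  simp only [hcond, if_false]
  symm
  -- `w` lies over some `ℓ ∤ N_E`: good reduction above `ℓ`
  set v : HeightOneSpectrum (𝓞 ℚ) := w.under (𝓞 ℚ) with hvdef
  set ℓ : ℕ := (Rat.HeightOneSpectrum.primesEquiv v : ℕ) with hℓdef
  haveI hℓ : Fact ℓ.Prime := ⟨(Rat.HeightOneSpectrum.primesEquiv v).2⟩
  have hvℓ : (Rat.HeightOneSpectrum.primesEquiv v : ℕ) = ℓ := rfl
  have hℓN : ¬ ℓ ∣ W.conductorNorm ℤ := fun h ↦ hcond ⟨hsplit ℓ h, h⟩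
  have hgood : W.HasGoodReductionAt v :=
    (hasGoodReductionAtPrime_primesEquiv_iff_holds W v ℓ hvℓ).mp
      (by
        by_contra hbad'
        exact hℓN ((W.dvd_conductorNorm_iff_not_hasGoodReductionAtPrime ℓ).mpr hbad'))
  haveI : w.asIdeal.LiesOver v.asIdeal := ⟨by rw [hvdef]; rfl⟩
  exact (W.baseChange K).localTamagawaNumber_eq_one_of_hasGoodReductionAt_holds w
    (hasGoodReductionAt_baseChange_of_hasGoodReductionAt_rat W v w hgood)

variable {W K}

/-- At a CLASSICAL HEEGNER field (`K` with every prime of `N = N_E` split) both identities hold; the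
`p`-adic readings for every prime `p`. [cite: JetchevSkinnerWan2017, §7.3.1 (eq:tamK)] -/
theorem padicValNat_tamagawa_of_heegner_anyPrime (p : ℕ) [Fact p.Prime] (hK : IsImaginaryQuadratic K)
    {N : ℕ} (hN : W.conductorNorm ℤ = N) (hH : SatisfiesHeegnerHypothesis N K) :
    padicValNat p (tamagawaProductSplit W K) = padicValNat p (W.baseChange K).tamagawaProduct ∧
      padicValNat p (W.baseChange K).tamagawaProduct = 2 * padicValNat p W.tamagawaProduct := by
  have hsplit : ∀ (ℓ : ℕ) [Fact ℓ.Prime], ℓ ∣ W.conductorNorm ℤ → SplitsIn K ℓ :=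
    fun ℓ _ hℓN ↦ hH ℓ Fact.out (hN ▸ hℓN)
  exact ⟨by rw [tamagawaProductSplit_eq_tamagawaProduct_baseChange_of_allSplit W K hsplit],
    padicValNat_tamagawaProduct_baseChange_eq_two_mul_of_allSplit W K p hK.1 hsplit⟩

end Tamagawa

/-! ### STEP L / the index identity from the good-ordinary links at a Heegner field, ANY prime -/

section Heegner

variable {W : WeierstrassCurve ℚ} [W.IsElliptic] [W.IsGloballyMinimal] {p : ℕ} [Fact p.Prime]
  {K : Type} [Field K] [NumberField K]

/-- **STEP L at a classical Heegner datum from the two good-`p` tree-object links, ANY prime `p`**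
(`K` imaginary quadratic with every `ℓ ∣ N_E` split, `Ш(E/K)` finite): (IMC≥∘BDP)ᵍ + (CTL)ᵍ at one
`(κ, γ, 𝔭, ι)` ⇒ `IndexLowerBoundAt W p K P`. The companion's
`indexLowerBoundAt_of_onTreeGoodLowerLinks_of_heegner` freed of `p ≥ 5` by the `p`-free Tamagawa
identities above. [cite: JetchevSkinnerWan2017, §7.4.1 (eq:shalowerK-1) and §7.3.1 (eq:tamK) (arXiv:1512.06894 p. 30)]
[cite: Castella2018, Thm. 2.3 (p. 5), Thm. 3.2 (p. 9)] -/
theorem indexLowerBoundAt_of_onTreeGoodLowerLinks_of_allSplit (hK : IsImaginaryQuadratic K)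
    {N : ℕ} (hN : W.conductorNorm ℤ = N) (hH : SatisfiesHeegnerHypothesis N K)
    {P : (W.baseChange K).toAffine.Point} [Finite (W.baseChange K).sha]
    {κ : ZpExtension K p} {𝔭 : HeightOneSpectrum (𝓞 K)} {γ : Field.absoluteGaloisGroup K}
    [Fact (κ.IsTopGenerator γ)] {ι : K →+* ℚ_[p]}
    (hIW : IMCLowerWaldspurgerOnTreeGoodAt p κ 𝔭 γ ι P) (hCTL : ControlOnTreeGoodAt p κ 𝔭 γ ι P) :
    IndexLowerBoundAt W p K P := by
  haveI : Finite (AddCommGroup.primaryComponent (W.baseChange K).sha p) :=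
    Finite.of_injective _ Subtype.val_injective
  have h := two_mul_index_le_of_onTreeGoodLowerLinks hIW hCTL
  obtain ⟨h1, h2⟩ := padicValNat_tamagawa_of_heegner_anyPrime p hK hN hH
  rw [h1, h2, padicValNat_card_addPrimaryComponent] at h
  unfold IndexLowerBoundAt
  rw [WeierstrassCurve.shaOrder]
  omega

/-- **The Heegner-index IDENTITY over `K` from the EQUALITY form, ANY prime `p`** (`X11b.IndexIdentityAt
W p K P`). [cite: Castella2018, §5 (5.2)–(5.3) (arXiv:1704.06608 p. 12)] [cite: GrossLMS1991, §2 Conj. (2.2)] -/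
theorem indexIdentityAt_of_onTreeGoodLinks_of_allSplit (hK : IsImaginaryQuadratic K)
    {N : ℕ} (hN : W.conductorNorm ℤ = N) (hH : SatisfiesHeegnerHypothesis N K)
    {P : (W.baseChange K).toAffine.Point} [Finite (W.baseChange K).sha]
    {κ : ZpExtension K p} {𝔭 : HeightOneSpectrum (𝓞 K)} {γ : Field.absoluteGaloisGroup K}
    [Fact (κ.IsTopGenerator γ)] {ι : K →+* ℚ_[p]}
    (hIW : IMCWaldspurgerOnTreeGoodAt p κ 𝔭 γ ι P) (hCTL : ControlOnTreeGoodAt p κ 𝔭 γ ι P) :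
    IndexIdentityAt W p K P := by
  haveI : Finite (AddCommGroup.primaryComponent (W.baseChange K).sha p) :=
    Finite.of_injective _ Subtype.val_injective
  have h := two_mul_index_eq_of_onTreeGoodLinks hIW hCTL
  obtain ⟨h1, h2⟩ := padicValNat_tamagawa_of_heegner_anyPrime p hK hN hH
  rw [h1, h2, padicValNat_card_addPrimaryComponent] at h
  unfold IndexIdentityAt
  rw [WeierstrassCurve.shaOrder]
  omega

/-- **Given (CTL)ᵍ, STEP L at the datum IS the one inequality (IMC≥∘BDP)ᵍ, ANY prime `p`.**
Bookkeeping. [folklore] -/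
theorem imcLowerWaldspurgerOnTreeGoodAt_iff_indexLowerBoundAt_of_allSplit (hK : IsImaginaryQuadratic K)
    {N : ℕ} (hN : W.conductorNorm ℤ = N) (hH : SatisfiesHeegnerHypothesis N K)
    {P : (W.baseChange K).toAffine.Point} [Finite (W.baseChange K).sha]
    {κ : ZpExtension K p} {𝔭 : HeightOneSpectrum (𝓞 K)} {γ : Field.absoluteGaloisGroup K}
    [Fact (κ.IsTopGenerator γ)] {ι : K →+* ℚ_[p]} (hCTL : ControlOnTreeGoodAt p κ 𝔭 γ ι P) :
    IMCLowerWaldspurgerOnTreeGoodAt p κ 𝔭 γ ι P ↔ IndexLowerBoundAt W p K P := by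
  refine ⟨fun h ↦ indexLowerBoundAt_of_onTreeGoodLowerLinks_of_allSplit hK hN hH h hCTL, fun h ↦ ?_⟩
  haveI : Finite (AddCommGroup.primaryComponent (W.baseChange K).sha p) :=
    Finite.of_injective _ Subtype.val_injective
  obtain ⟨n, hn, hne⟩ := hCTL
  refine ⟨n, hn, ?_⟩
  obtain ⟨h1, h2⟩ := padicValNat_tamagawa_of_heegner_anyPrime p hK hN hH
  rw [h1, h2, padicValNat_card_addPrimaryComponent] at hne
  unfold IndexLowerBoundAt at h
  rw [WeierstrassCurve.shaOrder] at h
  omega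

end Heegner

/-! ### The datum of the class theorems, ANY prime -/

section Datum

variable (W : WeierstrassCurve ℚ) [W.IsElliptic] [W.IsGloballyMinimal] (p : ℕ) [Fact p.Prime]
  (N : ℕ) [NeZero N] (K : Type) [Field K] [NumberField K]
  (Dt : ModularParametrizationData W N) (H : HeegnerDatum N (NumberField.discr K)) (ι : K →+* ℂ)
  (P : (W.baseChange K).toAffine.Point)

/-- **STEP L at a classical Heegner datum from the two good-`p` tree-object links at one
`(κ, γ, 𝔭, ιp)`, ANY prime `p`, finiteness of `Ш(E/K)` DISCHARGED** (Gross–Zagier + Kolyvagin +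
modularity at the non-torsion Heegner point). [cite: JetchevSkinnerWan2017, §7.4.1 (eq:shalowerK-1) (arXiv:1512.06894 p. 30)]
[cite: Castella2018, Thm. 2.3 (p. 5), Thm. 3.2 (p. 9)] [cite: Kolyvagin1990, Thm. A] [cite: GrossLMS1991, Thm. 1.3] -/
theorem indexLowerBoundAt_of_heegner_of_onTreeGoodLowerLinks_anyPrime
    (hGZ : gross_zagier N W K) (hKo : kolyvagin N W K) (hmod : hasEntireLFunction_rat)
    (hr : W.analyticRank = 1) (hN : W.conductorNorm ℤ = N) (hK : IsImaginaryQuadratic K)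
    (hHN : SatisfiesHeegnerHypothesis N K)
    (hLt : (W.quadraticTwist (NumberField.discr K : ℚ)).entireLFunction 1 ≠ 0)
    (hP : WeierstrassCurve.Affine.Point.map ι.toRatAlgHom P = heegnerPointComplex Dt H)
    {κ : ZpExtension K p} {𝔭 : HeightOneSpectrum (𝓞 K)} {γ : Field.absoluteGaloisGroup K}
    [Fact (κ.IsTopGenerator γ)] {ιp : K →+* ℚ_[p]}
    (hIW : IMCLowerWaldspurgerOnTreeGoodAt p κ 𝔭 γ ιp P) (hCTL : ControlOnTreeGoodAt p κ 𝔭 γ ιp P) :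
    IndexLowerBoundAt W p K P := by
  haveI : Finite (W.baseChange K).sha :=
    finite_sha_baseChange_of_heegner W N K Dt H ι P hGZ hKo hmod hr hK hHN hLt hP
  exact indexLowerBoundAt_of_onTreeGoodLowerLinks_of_allSplit hK hN hHN hIW hCTL

/-- **STEP L at a classical Heegner datum from the good-`p` tree-object links in route R1's idiom,
ANY prime `p`** (links for EVERY anticyclotomic `κ`, generator `γ`, degree-one `𝔭 ∋ p`, with THE
embedding `embAt`; `p` split in `K` = the hypothesis `SatisfiesHeegnerHypothesis p K`).
[cite: JetchevSkinnerWan2017, §7.4.1 (eq:shalowerK-1) (arXiv:1512.06894 p. 30)]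
[cite: Castella2018, §2.1, Thm. 2.3 (p. 5), Thm. 3.2 (p. 9)] [cite: YanZhu2024MainConjNonCM, Thm. 4.12 (p = 3 admitted)] -/
theorem indexLowerBoundAt_of_heegner_of_onTreeGoodInputs_anyPrime
    (hGZ : gross_zagier N W K) (hKo : kolyvagin N W K) (hmod : hasEntireLFunction_rat)
    (hr : W.analyticRank = 1) (hN : W.conductorNorm ℤ = N)
    (hK : IsImaginaryQuadratic K) (hHN : SatisfiesHeegnerHypothesis N K)
    (hHp : SatisfiesHeegnerHypothesis p K)
    (hLt : (W.quadraticTwist (NumberField.discr K : ℚ)).entireLFunction 1 ≠ 0)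
    (hP : WeierstrassCurve.Affine.Point.map ι.toRatAlgHom P = heegnerPointComplex Dt H)
    (hC : ∀ (κ : ZpExtension K p), κ.IsAnticyclotomic →
      ∀ (γ : Field.absoluteGaloisGroup K) [Fact (κ.IsTopGenerator γ)] (𝔭 : HeightOneSpectrum (𝓞 K))
        (h𝔭 : ((p : ℕ) : 𝓞 K) ∈ 𝔭.asIdeal) (he : 𝔭.asIdeal.ramificationIdx (𝓞 ℚ) = 1)
        (hf : 𝔭.asIdeal.inertiaDeg (𝓞 ℚ) = 1),
        ControlOnTreeGoodAt p κ 𝔭 γ (embAt K p 𝔭 h𝔭 he hf) P)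
    (hA : ∀ (κ : ZpExtension K p), κ.IsAnticyclotomic →
      ∀ (γ : Field.absoluteGaloisGroup K) [Fact (κ.IsTopGenerator γ)] (𝔭 : HeightOneSpectrum (𝓞 K))
        (h𝔭 : ((p : ℕ) : 𝓞 K) ∈ 𝔭.asIdeal) (he : 𝔭.asIdeal.ramificationIdx (𝓞 ℚ) = 1)
        (hf : 𝔭.asIdeal.inertiaDeg (𝓞 ℚ) = 1),
        IMCLowerWaldspurgerOnTreeGoodAt p κ 𝔭 γ (embAt K p 𝔭 h𝔭 he hf) P) :
    IndexLowerBoundAt W p K P := by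
  have hsplit : SplitsIn K p := hHp p Fact.out (dvd_refl p)
  obtain ⟨κ, γ, 𝔭, hκ, hγ, h𝔭⟩ := exists_anticyclotomic_generator_prime (p := p) hK
  haveI : Fact (κ.IsTopGenerator γ) := ⟨hγ⟩
  obtain ⟨he, hf⟩ := degreeOne_of_splitsIn hK.1 hsplit h𝔭
  exact indexLowerBoundAt_of_heegner_of_onTreeGoodLowerLinks_anyPrime W p N K Dt H ι P hGZ hKo hmod
    hr hN hK hHN hLt hP (hA κ hκ γ 𝔭 h𝔭 he hf) (hC κ hκ γ 𝔭 h𝔭 he hf)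

end Datum

end Summit.BirchSwinnertonDyer.Rank1Residual.X11b

end
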